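import Mathlib
import Literature.AlgebraicGeometry.Resolution.CobordantGame
import Summits.ResolutionOfSingularities.ResolutionOfSingularities.Theorems.WeightedInvariantLocalWeightedDropTwistedTrivialXOrder
import Summits.ResolutionOfSingularities.ResolutionOfSingularities.Theorems.WeightedConstruction.Negative.SatDirTwistedCylinderBk1

/-!
# Twisted arcs at the kangaroo-degenerate top move `bk2` (refuter evidence, crux `WeightedConstruction`)

[OURS · L1 W4.3 · refuter res-L1-w43-tri-1 (TRIAGER 1, lens KANGAROO-DISCHARGE), TRIAGE v9.5 §21.13 / v9.6 §21.14 ·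
supports stmt-ResolutionOfSingularities-0571 · AI-written, weaker than expert review; nothing here is a statement
about resolution of singularities.]

The specimen `bk2` (characteristic 2) is the top move of the kangaroo-degenerate point
`𝔨_deg = X² + wA⁴ + w³b⁴d⁴`: weighted blow-up of `(X,A,b,d,w; 10,4,1,1,4)`, chart `w = s⁴(1+v)`; the strict
transform is `g = X² + (1+v)A⁴ + (1+v)³b⁴d⁴` (`Negative.KDegenIdentities`, D4), its slice `v = 0` is the SQUARE
`h = X² + A⁴ + b⁴d⁴ = (X + A² + b²d²)²`, and the renormalised successor of idea-1's Sketch v5 §11c-5 (`g ∘ Λ₄`) is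
`G = (1+v)⁶X² + (1+v)⁵A⁴ + (1+v)¹¹b⁴d⁴`.

With the tree predicate `Theorems.GradedGame.TwistedTrivialAlongFix` we prove, re-using the coefficient lemmas of
`Negative.SatDirTwistedCylinderBk1`:

* `bk2_slice_twistedTrivialFix` — the slice `h` (variables `0 = s` idle, `1 = X, 2 = A, 3 = b, 4 = d`) is
  twisted-trivial of exponent `2⁰` along the NON-GRADED arc `γ = (0, σ², σ, 0, 0)` (`h(X+σ², A+σ, b, d) = h` in
  characteristic 2, `Φ = id`, `u = 1`): `X` (and `A`) are «saturated directions» of `h` (Sketch v5 `satDir`).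
* `bk2_successor_arc_X_eq_zero` — for EVERY arc `γ` along which `G` (variables `0 = s, 1 = X, 2 = A, 3 = b, 4 = d,
  5 = v`) is twisted-trivial (any exponent): `γ_X = 0` and `γ_A⁴ = γ_b⁴γ_d⁴(1+γ_v)⁶`.  Mechanism: by
  `Theorems.GradedGame.xOrderGE_of_twistedTrivialAlongFix` the translate `G(x + γ(σ))` has `x`-order `≥ 2`; its
  `x`-constant part `γ_X²c⁶ + γ_A⁴c⁵ + γ_b⁴γ_d⁴c¹¹` and its `x_v`-linear part `6γ_X²c⁵ + 5γ_A⁴c⁴ + 11γ_b⁴γ_d⁴c¹⁰`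
  (`c = 1 + γ_v`, a unit) vanish; characteristic 2 does the rest.  (All mixed second `x`-partials of `G` vanish in
  characteristic 2, so coefficient extraction stops here; the full statement `γ_A = γ_b = γ_d = 0` is proved by hand
  in TRIAGE v9.6a §21.14a with relative Tjurina ideals, Frobenius descent and Fitting ideals — not in this file.)

Consequence (prose): idea-1's round-5 wild clause `Round5.SatDirTwistedCylinder` fails at `bk2` as it does at
`bk1` (`X ∈ satDir 2 h`, `X ∉ satDir 2 (g∘Λ₄)`), at THE kangaroo-degenerate point of the lens; the repair C″
(credit only GRADED arcs of `h`) predicts `satDir = {s, v}` there.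
-/

set_option linter.dupNamespace false -- mandated namespace of this single-conjunct summit
set_option autoImplicit false

namespace Summit.ResolutionOfSingularities.ResolutionOfSingularities.Theorems.WeightedConstruction.Negative.SatDirTwistedCylinderBk2

open MvPowerSeries
open Summit.ResolutionOfSingularities.ResolutionOfSingularities.Theorems.GradedGame
open Summit.ResolutionOfSingularities.ResolutionOfSingularities.Theorems.WeightedConstruction.Negative.SatDirTwistedCylinderBk1

variable {k : Type} [Field k]

/-! ## The slice `h = X² + A⁴ + b⁴d⁴` has the non-graded twisted-trivial direction `(σ², σ, 0, 0)` -/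

/-- `bk2`, SLICE: `h = X² + A⁴ + b⁴d⁴` (char 2; `0 = s` idle, `1 = X`, `2 = A`, `3 = b`, `4 = d`) is twisted-trivial
of exponent `2⁰` along `γ = (0, σ², σ, 0, 0)`: `h(s, X+σ², A+σ, b, d) = X² + σ⁴ + A⁴ + σ⁴ + b⁴d⁴ = h`, so `Φ = id`,
`u = 1`; hence `X` (and `A`) lie in Sketch v5's `satDir 2 h`.  The arc is NOT graded (it mixes the isotypic pieces
`X² | A⁴ | b⁴d⁴` of weights `6 | 5 | 11`), which is what C″ discards. [OURS · L1 W4.3 · tri-1 TRIAGE v9.5 §21.13] -/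
theorem bk2_slice_twistedTrivialFix [CharP k 2] :
    TwistedTrivialAlongFix 2 (X 1 ^ 2 + X 2 ^ 4 + X 3 ^ 4 * X 4 ^ 4 : MvPowerSeries (Fin 5) k)
      (fun i => if i = 1 then X 0 ^ 2 else if i = 2 then X 0 else 0) := by
  classical
  haveI : CharP (MvPowerSeries (Fin (5 + 1)) k) 2 := charP_of_injective_ringHom C_injective 2
  have h2 : (2 : MvPowerSeries (Fin (5 + 1)) k) = 0 := CharP.ofNat_eq_zero _ 2
  set γ : Fin 5 → MvPowerSeries (Fin 1) k := fun i => if i = 1 then X 0 ^ 2 else if i = 2 then X 0 else 0 with hγ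
  have ha := hasSubst_sigma (k := k) 5
  have hK := hasSubst_keep (k := k) (fun v : Fin (5 + 1) => v = 0)
  have hKeq : (fun v : Fin (5 + 1) => if v = 0 then (X (0 : Fin (5 + 1)) : MvPowerSeries (Fin (5 + 1)) k) else 0) =
      fun v : Fin (5 + 1) => if v = 0 then (X v : MvPowerSeries (Fin (5 + 1)) k) else 0 := by
    funext v; by_cases hv : v = 0 <;> simp [hv]
  have hγ0 : ∀ i, constantCoeff (γ i) = 0 := fun i => by
    simp only [hγ]; split_ifs <;> simp [constantCoeff_X]
  -- the `σ`-images of the arc components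
  have hS : ∀ i, subst (fun _ : Fin 1 => (X (0 : Fin (5 + 1)) : MvPowerSeries (Fin (5 + 1)) k) ^ (2 ^ 0)) (γ i) =
      if i = 1 then X 0 ^ 2 else if i = 2 then X 0 else 0 := by
    intro i
    simp only [hγ]
    split_ifs
    · rw [subst_pow ha, subst_X ha]; simp
    · rw [subst_X ha]; simp
    · rw [← coe_substAlgHom ha, map_zero]
  refine ⟨hγ0, 0, fun j => X j.succ, 1, isUnit_one, fun j => constantCoeff_X _, fun j => ?_, ?_, ?_⟩
  · rw [hKeq, subst_X hK]
    simp [Fin.succ_ne_zero]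
  · have hM : (Matrix.of fun i j : Fin 5 =>
          coeff (Finsupp.single j.succ 1) (X i.succ : MvPowerSeries (Fin (5 + 1)) k)) = 1 := by
      ext i j
      rw [Matrix.of_apply, coeff_X, Matrix.one_apply]
      by_cases h : i = j
      · subst h; simp
      · rw [if_neg, if_neg h]
        intro h'
        exact h ((Fin.succ_injective _ ((Finsupp.single_left_inj one_ne_zero).mp h')).symm)
    rw [hM, Matrix.det_one]
    exact isUnit_one
  · have hT := hasSubst_translateFamily (k := k) (2 ^ 0) (by norm_num) γ hγ0
    have hI : HasSubst (fun j : Fin 5 => (X j.succ : MvPowerSeries (Fin (5 + 1)) k)) :=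
      hasSubst_of_constantCoeff_zero fun j => constantCoeff_X _
    rw [one_mul]
    rw [← coe_substAlgHom hT]
    simp only [← coe_substAlgHom hI, map_add, map_mul, map_pow, substAlgHom_X, hS]
    simp only [Fin.isValue, Fin.reduceEq, ↓reduceIte]
    linear_combination (X 0 ^ 4 + X (Fin.succ (1 : Fin 5)) * X 0 ^ 2 + 2 * X (Fin.succ (2 : Fin 5)) ^ 3 * X 0
      + 3 * X (Fin.succ (2 : Fin 5)) ^ 2 * X 0 ^ 2 + 2 * X (Fin.succ (2 : Fin 5)) * X 0 ^ 3 :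
        MvPowerSeries (Fin (5 + 1)) k) * h2


/-! ## Every twisted arc of `G = (1+v)⁶X² + (1+v)⁵A⁴ + (1+v)¹¹b⁴d⁴` has `γ_X = 0` and `γ_A⁴ = γ_b⁴γ_d⁴(1+γ_v)⁶` -/

/-- `bk2`, SUCCESSOR: if `G = X²(1+v)⁶ + A⁴(1+v)⁵ + b⁴d⁴(1+v)¹¹` (char 2; `0 = s` idle, `1 = X`, `2 = A`, `3 = b`,
`4 = d`, `5 = v`) is twisted-trivial along the arc `γ` (tree predicate, any Frobenius exponent), then `γ_X = 0` and
`γ_A⁴ = γ_b⁴ γ_d⁴ (1 + γ_v)⁶`.  In particular the direction `X ∈ satDir 2 h` of `bk2_slice_twistedTrivialFix` is NOT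
a saturated direction of `G = g ∘ Λ₄`, against `Round5.SatDirTwistedCylinder` at the kangaroo-degenerate top move;
consistent with the repair C″ (`satDir 2 G = {s, v}`, TRIAGE v9.6a §21.14a by hand).
[OURS · L1 W4.3 · tri-1 TRIAGE v9.5 §21.13 (bk2) / v9.6 §21.14 (B)] -/
theorem bk2_successor_arc_X_eq_zero [CharP k 2] (γ : Fin 6 → MvPowerSeries (Fin 1) k)
    (hγ : TwistedTrivialAlongFix 2
      (X 1 ^ 2 * (1 + X 5) ^ 6 + X 2 ^ 4 * (1 + X 5) ^ 5 + X 3 ^ 4 * (X 4 ^ 4 * (1 + X 5) ^ 11) :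
        MvPowerSeries (Fin 6) k) γ) :
    γ 1 = 0 ∧ γ 2 ^ 4 = γ 3 ^ 4 * γ 4 ^ 4 * (1 + γ 5) ^ 6 := by
  classical
  set G : MvPowerSeries (Fin 6) k :=
    X 1 ^ 2 * (1 + X 5) ^ 6 + X 2 ^ 4 * (1 + X 5) ^ 5 + X 3 ^ 4 * (X 4 ^ 4 * (1 + X 5) ^ 11) with hG
  have hγ0 : ∀ i, constantCoeff (γ i) = 0 := hγ.1
  -- characteristic 2 in `k⟦σ⟧`
  haveI : CharP (MvPowerSeries (Fin 1) k) 2 := charP_of_injective_ringHom C_injective 2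
  have h2 : (2 : MvPowerSeries (Fin 1) k) = 0 := CharP.ofNat_eq_zero _ 2
  -- `G ∈ 𝔪²`
  have hO : OrderGE 2 G := by
    intro m hm
    by_contra hlt
    push Not at hlt
    have h1 : m 1 < 2 := lt_of_le_of_lt
      (Finset.single_le_sum (f := fun i => m i) (fun i _ => Nat.zero_le _) (Finset.mem_univ (1 : Fin 6))) hlt
    have h2' : m 2 < 4 := lt_of_le_of_lt
      (Finset.single_le_sum (f := fun i => m i) (fun i _ => Nat.zero_le _) (Finset.mem_univ (2 : Fin 6))) (by omega)
    have h3 : m 3 < 4 := lt_of_le_of_lt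
      (Finset.single_le_sum (f := fun i => m i) (fun i _ => Nat.zero_le _) (Finset.mem_univ (3 : Fin 6))) (by omega)
    apply hm
    rw [hG, map_add, map_add, X_pow_eq (1 : Fin 6) 2, X_pow_eq (2 : Fin 6) 4, X_pow_eq (3 : Fin 6) 4,
      coeff_monomial_mul, coeff_monomial_mul, coeff_monomial_mul, if_neg, if_neg, if_neg, add_zero, add_zero]
    · exact fun h => absurd (Finsupp.single_le_iff.mp h) (by omega)
    · exact fun h => absurd (Finsupp.single_le_iff.mp h) (by omega)
    · exact fun h => absurd (Finsupp.single_le_iff.mp h) (by omega)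
  -- the translate `G(x + γ(σ))` has `x`-order ≥ 2 (R4-1), so its coefficients of `x`-degree ≤ 1 vanish
  have hX := xOrderGE_of_twistedTrivialAlongFix 2 two_ne_zero 2 G γ hO hγ 0
  have hcoef : ∀ μ : Fin (6 + 1) →₀ ℕ, (∑ i : Fin 6, μ i.succ) < 2 → coeff μ (translateAlong 2 0 G γ) = 0 := by
    intro μ hμ
    by_contra h
    have := hX μ h
    omega
  have ha := hasSubst_sigma (k := k) 6
  have haS0 : ∀ i, constantCoeff (subst (fun _ : Fin 1 => (X (0 : Fin (6 + 1)) : MvPowerSeries (Fin (6 + 1)) k) ^ (2 ^ 0)) (γ i)) = 0 := fun i =>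
    constantCoeff_subst_eq_zero ha (fun _ => by simp [constantCoeff_X]) (hγ0 i)
  -- STEP 0 (kill every `x`-variable): the `x`-constant part `q₀ = γ_X²c⁶ + γ_A⁴c⁵ + γ_b⁴γ_d⁴c¹¹` vanishes
  have hfam0 : (fun i : Fin 6 => (if (i.succ : Fin (6 + 1)) = 0 then (X i.succ : MvPowerSeries (Fin (6 + 1)) k) else 0)
      + subst (fun _ : Fin 1 => (X (0 : Fin (6 + 1)) : MvPowerSeries (Fin (6 + 1)) k) ^ (2 ^ 0)) (γ i)) =
      fun i : Fin 6 => subst (fun _ : Fin 1 => (X (0 : Fin (6 + 1)) : MvPowerSeries (Fin (6 + 1)) k) ^ (2 ^ 0)) (γ i) := by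
    funext i
    rw [if_neg (Fin.succ_ne_zero i), zero_add]
  have hT0 : HasSubst (fun i : Fin 6 => subst (fun _ : Fin 1 => (X (0 : Fin (6 + 1)) : MvPowerSeries (Fin (6 + 1)) k) ^ (2 ^ 0)) (γ i)) := hasSubst_of_constantCoeff_zero haS0
  have hE0 : subst (fun v : Fin (6 + 1) => if v = 0 then (X v : MvPowerSeries (Fin (6 + 1)) k) else 0)
        (translateAlong 2 0 G γ) = subst (fun _ : Fin 1 => (X (0 : Fin (6 + 1)) : MvPowerSeries (Fin (6 + 1)) k) ^ (2 ^ 0)) (γ 1 ^ 2 * (1 + γ 5) ^ 6 + γ 2 ^ 4 * (1 + γ 5) ^ 5 + γ 3 ^ 4 * (γ 4 ^ 4 * (1 + γ 5) ^ 11)) := by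
    rw [subst_keep_translateAlong (fun v : Fin (6 + 1) => v = 0) rfl γ hγ0 G, hfam0, hG, ← coe_substAlgHom hT0]
    simp only [map_add, map_mul, map_pow, map_one, substAlgHom_X]
    conv_rhs => rw [← coe_substAlgHom ha]; simp only [map_add, map_mul, map_pow, map_one]
    rw [coe_substAlgHom ha]
  have hq0 : (γ 1 ^ 2 * (1 + γ 5) ^ 6 + γ 2 ^ 4 * (1 + γ 5) ^ 5 + γ 3 ^ 4 * (γ 4 ^ 4 * (1 + γ 5) ^ 11)) = 0 := by
    apply eq_zero_of_coeff_single
    intro m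
    rw [← coeff_single_subst_sigma (N := 6), ← hE0,
      coeff_subst_keep _ _ _ (fun v hv => by
        by_contra h
        exact hv (by rw [Finsupp.single_apply, if_neg (Ne.symm h)])),
      hcoef _ (by simp only [single_zero_apply_succ, Finset.sum_const_zero]; norm_num)]
  have hq0' : subst (fun _ : Fin 1 => (X (0 : Fin (6 + 1)) : MvPowerSeries (Fin (6 + 1)) k) ^ (2 ^ 0)) (γ 1 ^ 2 * (1 + γ 5) ^ 6 + γ 2 ^ 4 * (1 + γ 5) ^ 5 + γ 3 ^ 4 * (γ 4 ^ 4 * (1 + γ 5) ^ 11)) = 0 := by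
    rw [hq0, ← coe_substAlgHom ha, map_zero]
  -- STEP v (keep `σ` and `x_v = X (succ 5)`): the `x_v`-linear part `6γ_X²c⁵ + 5γ_A⁴c⁴ + 11γ_b⁴γ_d⁴c¹⁰` vanishes
  have hfamv : (fun i : Fin 6 => (if ((i.succ : Fin (6 + 1)) = 0 ∨ (i.succ : Fin (6 + 1)) = Fin.succ 5)
        then (X i.succ : MvPowerSeries (Fin (6 + 1)) k) else 0) + subst (fun _ : Fin 1 => (X (0 : Fin (6 + 1)) : MvPowerSeries (Fin (6 + 1)) k) ^ (2 ^ 0)) (γ i)) =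
      fun i : Fin 6 => (if i = 5 then (X i.succ : MvPowerSeries (Fin (6 + 1)) k) else 0) + subst (fun _ : Fin 1 => (X (0 : Fin (6 + 1)) : MvPowerSeries (Fin (6 + 1)) k) ^ (2 ^ 0)) (γ i) := by
    funext i
    by_cases hi : i = 5
    · subst hi; simp
    · rw [if_neg, if_neg hi]
      rintro (h | h)
      · exact Fin.succ_ne_zero _ h
      · exact hi (Fin.succ_injective _ h)
  have hTv : HasSubst (fun i : Fin 6 => (if i = 5 then (X i.succ : MvPowerSeries (Fin (6 + 1)) k) else 0)
      + subst (fun _ : Fin 1 => (X (0 : Fin (6 + 1)) : MvPowerSeries (Fin (6 + 1)) k) ^ (2 ^ 0)) (γ i)) :=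
    hasSubst_of_constantCoeff_zero fun i => by
      rw [map_add, haS0 i, add_zero]
      split_ifs <;> simp [constantCoeff_X]
  -- binomial remainders: `(c + x)^n = c^n + n c^(n-1) x + x² Rₙ`
  obtain ⟨R6, h6⟩ := sq_dvd_add_pow_sub_sub (X (Fin.succ 5) : MvPowerSeries (Fin (6 + 1)) k) (1 + subst (fun _ : Fin 1 => (X (0 : Fin (6 + 1)) : MvPowerSeries (Fin (6 + 1)) k) ^ (2 ^ 0)) (γ 5)) 6
  obtain ⟨R5, h5⟩ := sq_dvd_add_pow_sub_sub (X (Fin.succ 5) : MvPowerSeries (Fin (6 + 1)) k) (1 + subst (fun _ : Fin 1 => (X (0 : Fin (6 + 1)) : MvPowerSeries (Fin (6 + 1)) k) ^ (2 ^ 0)) (γ 5)) 5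
  obtain ⟨R11, h11⟩ := sq_dvd_add_pow_sub_sub (X (Fin.succ 5) : MvPowerSeries (Fin (6 + 1)) k) (1 + subst (fun _ : Fin 1 => (X (0 : Fin (6 + 1)) : MvPowerSeries (Fin (6 + 1)) k) ^ (2 ^ 0)) (γ 5)) 11
  rw [show (6 : ℕ) - 1 = 5 from rfl] at h6
  rw [show (5 : ℕ) - 1 = 4 from rfl] at h5
  rw [show (11 : ℕ) - 1 = 10 from rfl] at h11
  have hEv : subst (fun v : Fin (6 + 1) => if (v = 0 ∨ v = Fin.succ 5) then (X v : MvPowerSeries (Fin (6 + 1)) k) else 0)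
        (translateAlong 2 0 G γ) =
      X (Fin.succ 5) * subst (fun _ : Fin 1 => (X (0 : Fin (6 + 1)) : MvPowerSeries (Fin (6 + 1)) k) ^ (2 ^ 0))
          (6 * γ 1 ^ 2 * (1 + γ 5) ^ 5 + 5 * γ 2 ^ 4 * (1 + γ 5) ^ 4 + 11 * (γ 3 ^ 4 * γ 4 ^ 4) * (1 + γ 5) ^ 10)
      + X (Fin.succ 5) ^ 2 *
          (subst (fun _ : Fin 1 => (X (0 : Fin (6 + 1)) : MvPowerSeries (Fin (6 + 1)) k) ^ (2 ^ 0)) (γ 1) ^ 2 * R6 + subst (fun _ : Fin 1 => (X (0 : Fin (6 + 1)) : MvPowerSeries (Fin (6 + 1)) k) ^ (2 ^ 0)) (γ 2) ^ 4 * R5 + subst (fun _ : Fin 1 => (X (0 : Fin (6 + 1)) : MvPowerSeries (Fin (6 + 1)) k) ^ (2 ^ 0)) (γ 3) ^ 4 * (subst (fun _ : Fin 1 => (X (0 : Fin (6 + 1)) : MvPowerSeries (Fin (6 + 1)) k) ^ (2 ^ 0)) (γ 4) ^ 4 * R11))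
      + subst (fun _ : Fin 1 => (X (0 : Fin (6 + 1)) : MvPowerSeries (Fin (6 + 1)) k) ^ (2 ^ 0))
          (γ 1 ^ 2 * (1 + γ 5) ^ 6 + γ 2 ^ 4 * (1 + γ 5) ^ 5 + γ 3 ^ 4 * (γ 4 ^ 4 * (1 + γ 5) ^ 11)) := by
    rw [subst_keep_translateAlong (fun v : Fin (6 + 1) => v = 0 ∨ v = Fin.succ 5) (Or.inl rfl) γ hγ0 G, hfamv, hG,
      ← coe_substAlgHom hTv]
    simp only [map_add, map_mul, map_pow, map_one]
    rw [substAlgHom_X, substAlgHom_X, substAlgHom_X, substAlgHom_X, substAlgHom_X]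
    simp only [Fin.isValue, Fin.reduceEq, ↓reduceIte, zero_add]
    conv_rhs => rw [← coe_substAlgHom ha]; simp only [map_add, map_mul, map_pow, map_one, map_ofNat]
    rw [coe_substAlgHom ha]
    linear_combination subst (fun _ : Fin 1 => (X (0 : Fin (6 + 1)) : MvPowerSeries (Fin (6 + 1)) k) ^ (2 ^ 0)) (γ 1) ^ 2 * h6 + subst (fun _ : Fin 1 => (X (0 : Fin (6 + 1)) : MvPowerSeries (Fin (6 + 1)) k) ^ (2 ^ 0)) (γ 2) ^ 4 * h5 + subst (fun _ : Fin 1 => (X (0 : Fin (6 + 1)) : MvPowerSeries (Fin (6 + 1)) k) ^ (2 ^ 0)) (γ 3) ^ 4 * subst (fun _ : Fin 1 => (X (0 : Fin (6 + 1)) : MvPowerSeries (Fin (6 + 1)) k) ^ (2 ^ 0)) (γ 4) ^ 4 * h11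
  have hrv : (6 * γ 1 ^ 2 * (1 + γ 5) ^ 5 + 5 * γ 2 ^ 4 * (1 + γ 5) ^ 4 + 11 * (γ 3 ^ 4 * γ 4 ^ 4) * (1 + γ 5) ^ 10 :
      MvPowerSeries (Fin 1) k) = 0 := by
    apply eq_zero_of_coeff_single
    intro m
    have hc := hcoef (Finsupp.single 0 m + Finsupp.single (Fin.succ 5) 1) (by
      simp only [Finsupp.add_apply, single_zero_apply_succ, single_succ_apply_succ, zero_add, Finset.sum_ite_eq,
        Finset.mem_univ, if_true]
      norm_num)
    rw [← coeff_subst_keep (fun v : Fin (6 + 1) => v = 0 ∨ v = Fin.succ 5) _ _ (fun v hv => by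
        by_contra h
        push Not at h
        apply hv
        rw [Finsupp.add_apply, Finsupp.single_apply, if_neg (Ne.symm h.1), Finsupp.single_apply,
          if_neg (Ne.symm h.2), add_zero]),
      hEv, hq0', add_zero, map_add, coeff_single_add_X_mul, coeff_single_add_X_sq_mul _ _ (Fin.succ_ne_zero 5),
      add_zero, coeff_single_subst_sigma (N := 6)] at hc
    exact hc
  -- CONCLUSION in `k⟦σ⟧` (char 2, `1 + γ_v` a unit, no zero divisors)
  have h15 : (1 + γ 5 : MvPowerSeries (Fin 1) k) ≠ 0 := fun h => by
    have h' := congrArg constantCoeff h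
    rw [map_add, map_one, hγ0 5, add_zero, map_zero] at h'
    exact one_ne_zero h'
  have hA : γ 2 ^ 4 + γ 3 ^ 4 * γ 4 ^ 4 * (1 + γ 5) ^ 6 = 0 := by
    have e : (1 + γ 5) ^ 4 * (γ 2 ^ 4 + γ 3 ^ 4 * γ 4 ^ 4 * (1 + γ 5) ^ 6) = 0 := by
      linear_combination hrv
        - (3 * γ 1 ^ 2 * (1 + γ 5) ^ 5 + 2 * γ 2 ^ 4 * (1 + γ 5) ^ 4
            + 5 * (γ 3 ^ 4 * γ 4 ^ 4) * (1 + γ 5) ^ 10) * h2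
    rcases mul_eq_zero.mp e with h | h
    · exact absurd ((pow_eq_zero_iff (by norm_num)).mp h) h15
    · exact h
  have hγ1 : γ 1 = 0 := by
    have e : γ 1 ^ 2 * (1 + γ 5) ^ 6 = 0 := by
      linear_combination hq0 - (1 + γ 5) ^ 5 * hA
    rcases mul_eq_zero.mp e with h | h
    · exact (pow_eq_zero_iff two_ne_zero).mp h
    · exact absurd ((pow_eq_zero_iff (by norm_num)).mp h) h15
  have hrel : γ 2 ^ 4 = γ 3 ^ 4 * γ 4 ^ 4 * (1 + γ 5) ^ 6 := by
    linear_combination hA - (γ 3 ^ 4 * γ 4 ^ 4 * (1 + γ 5) ^ 6) * h2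
  exact ⟨hγ1, hrel⟩

end Summit.ResolutionOfSingularities.ResolutionOfSingularities.Theorems.WeightedConstruction.Negative.SatDirTwistedCylinderBk2
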